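/-
Copyright (c) 2026. All rights reserved.
Released under Apache 2.0 license as described in the file LICENSE.
Authors: HodgeCM publication cell (pub-hodgecm), model-construction sub-cell, construction prover `mc-weil-1`.
-/
import Literature.RepresentationTheory.HeisenbergGroup.RankOneUnramified
import Literature.RepresentationTheory.HeisenbergGroup.SchrodingerCommutant
import Literature.RepresentationTheory.HeisenbergGroup.ImplementerCocycle
import Literature.NumberTheory.Automorphic.SmoothRepresentation

/-!
# Rank one: the normalised local section `g ↦ r_ψ(g)`, its cocycle, and the compact open splitting (KERNEL)

Topic `RepresentationTheory/HeisenbergGroup`; namespace `Literature.RepresentationTheory.HeisenbergGroup`.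

`F` a non-archimedean local field with `2` invertible; an `UnramifiedDatum ψ μ` (`hd`): `ψ` continuous non-trivial
of conductor exponent `0`, `μ` a self-dual Haar measure for `ψ` (these EXIST: `TateSelfDualHaar`), `⅟2 ∈ 𝒪`; `ρ_ψ`
(`rhoPsi`) the smooth Schrödinger model on `𝒮(F)`, `K = SL₂(𝒪) = integralSp₁ F ≤ SL₂(F) = Sp(F × F)`. The section
is chosen (`Classical.choose`) from KERNEL existence theorems and is CHARACTERISED on `K` (`eq_localSection`), so no
datum is manufactured: every property below is proved.

* §1 **the normalised section** `localSectionFun … g : 𝒮(F) ≃ₗ[ℂ] 𝒮(F)`: an implementer of `g` (condition (A)) —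
  for `g ∈ K` THE implementer fixing the unramified vector `1_𝒪` (it exists by `RankOneUnramified`, and is unique:
  implementers are unique up to a scalar, `SchrodingerCommutant`, and `1_𝒪 ≠ 0`), for `g ∉ K` some implementer
  (`RankOneGeneration`). `localSectionFun_one : r(1) = 1`; **`eq_localSectionFun`**: an implementer of `g ∈ K` fixing
  `1_𝒪` IS `r(g)`; hence **`localSectionFun_mul_of_mem`**: `r(kk') = r(k) r(k')` on `K`; bundled as the normalised
  section **`localSection μ hd : ImplementerSection ρ_ψ`** (`ImplementerCocycle`), and the homomorphism
  **`localSectionK : K →* (𝒮(F) ≃ₗ[ℂ] 𝒮(F))`** / `liftK : K →* S̃p_ψ` — the COMPACT OPEN SPLITTING of MVW Chap. 2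
  II.10 over the stabiliser of the self-dual lattice `𝒪 ⊕ 𝒪`, KERNEL in rank one;
* §2 **the cocycle** `localCocycle μ hd : CentralCocycle SL₂(F) ℂˣ` of this section (the general construction
  `ImplementerSection.cocycle` fed with the rank-one uniqueness THEOREM), with `r(g) r(g') = c(g,g') r(gg')`
  (`localSection_mul_apply`, and the tree's `TwistedProduct.HasMultiplier` shape `hasMultiplier_localSection`),
  normalised, and **trivial on `K × K`** (`localCocycle_eq_one_of_mem`); the Weil representation
  `localWeilOp μ hd : SL₂(F) ×_c ℂˣ →* End(𝒮(F))`, `(g,a) ↦ a · r(g)`, and the splitting of `K`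
  (`isSplitting_integralSp₁`). With `r(k) 1_𝒪 = 1_𝒪` (`localSection_unramifiedVector`) this is exactly the local data
  (`r_v`, `c_v`, `h1`, `hK`) a restricted tensor product `⊗'_v ω_v` consumes at an unramified place — all PROVED;
* §3 the same data in the GROUP shape a restricted product `Πʳ_v [G v, Kc v]` consumes: `G = S̃p_ψ = MpPsi ρ_ψ` acting
  tautologically (`MpPsi.toRep`), `Kc = unramifiedStabilizer μ hd := range (liftK)` (the lifted `SL₂(𝒪)`), and
  **`unramifiedVector_mem_fixedPoints : 1_𝒪 ∈ (MpPsi.toRep ρ_ψ).fixedPoints (unramifiedStabilizer μ hd)`**;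
* §4 ANY conductor (ramified places): for every continuous non-trivial `ψ` and self-dual `μ` a normalised section
  `rankOneSection μ hψ hμ : ImplementerSection ρ_ψ` (`ImplementerSection.ofExists` on the rank-one existence THEOREM) with
  its cocycle `rankOneCocycle`, multiplier relation and Weil representation of the twisted product — KERNEL.
-/

set_option autoImplicit false

noncomputable section

namespace Literature.RepresentationTheory.HeisenbergGroup

open _root_.MeasureTheory
open Literature.NumberTheory.Automorphic
open Literature.NumberTheory.GaloisRepresentations.IsNonarchimedeanLocalField
open Literature.GroupTheory

variable {F : Type*} [Field F] [ValuativeRel F] [TopologicalSpace F] [IsNonarchimedeanLocalField F]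

local notation "Sp₁" => symplecticGroup (polar (LinearMap.mul F F))

/-- the smooth Schrödinger model `ρ_ψ` of `F × F` on `𝒮(F)` for a continuous non-trivial `ψ` (abbreviation).
[cite: MoeglinVignerasWaldspurger1987, Chap. 2 II.6] -/
abbrev rhoPsi {ψ : AddChar F Circle} (hψ : ψ.IsContinuousNontrivial) :
    Representation ℂ (Heisenberg (polar (LinearMap.mul F F))) (SchwartzBruhat F) :=
  schrodingerSB (LinearMap.mul F F) ψ (isLocallyConstant_of_isContinuousNontrivial hψ) continuous_mul_left_apply

/-- the unramified vector is non-zero (`1_𝒪(0) = 1`). [folklore] -/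
theorem unramifiedVector_ne_zero : (unramifiedVector F : SchwartzBruhat F) ≠ 0 :=
  ballSB_zero_ne_zero

/-- `𝒮(F) ≠ 0`. [folklore] -/
instance nontrivial_schwartzBruhat : Nontrivial (SchwartzBruhat F) :=
  ⟨⟨unramifiedVector F, 0, unramifiedVector_ne_zero⟩⟩

/-- **unramified rank-one datum**: `ψ` continuous non-trivial of conductor exponent `0`, `μ` self-dual for `ψ`,
and `⅟2 ∈ 𝒪` (residual characteristic `≠ 2`) — the hypotheses of MVW Chap. 2 II.10 at a finite place, bundled.
(Self-dual `μ` exist for every `ψ`: `exists_isSelfDualMeasure`.) [cite: MoeglinVignerasWaldspurger1987, Chap. 2 II.10] -/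
structure UnramifiedDatum [Invertible (2 : F)] [MeasurableSpace F] (ψ : AddChar F Circle) (μ : Measure F) : Prop where
  /-- `ψ` is continuous and non-trivial -/
  cont : ψ.IsContinuousNontrivial
  /-- `ψ` has conductor exponent `0` (trivial on `𝒪`, not on `𝔭⁻¹`) -/
  cond : ψ.HasConductorExp 0
  /-- `μ` is self-dual for `ψ` -/
  selfDual : IsSelfDualMeasure ψ μ
  /-- `2` is a unit of `𝒪` -/
  two_mem : ⅟(2 : F) ∈ primePowBall F 0

variable [Invertible (2 : F)] [MeasurableSpace F] [BorelSpace F]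
variable {ψ : AddChar F Circle} (μ : Measure F) [μ.IsAddHaarMeasure] (hd : UnramifiedDatum ψ μ)

include hd

omit [BorelSpace F] [μ.IsAddHaarMeasure] in
/-- uniqueness up to scalars for `ρ_ψ` (the rank-one THEOREM of `SchrodingerCommutant`).
[cite: MoeglinVignerasWaldspurger1987, Chap. 2 II.1 (B)] -/
theorem UnramifiedDatum.unique : ImplementerUniqueUpToScalar (rhoPsi hd.cont) :=
  implementerUniqueUpToScalar_schrodingerSB_rankOne _ _ hd.cont

/-! ## §1 The normalised section -/

section Section

open scoped Classical in
/-- **the normalised local section** `r_ψ : SL₂(F) → GL(𝒮(F))`: for `g ∈ K = SL₂(𝒪)` the implementer of `g` fixing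
`1_𝒪`, otherwise some implementer of `g`. [cite: MoeglinVignerasWaldspurger1987, Chap. 2 II.10] -/
def localSectionFun (g : Sp₁) : SchwartzBruhat F ≃ₗ[ℂ] SchwartzBruhat F :=
  if hg : g ∈ integralSp₁ F then
    Classical.choose (exists_implementer_fixing_unramifiedVector ψ μ hd.cont hd.cond hd.selfDual hd.two_mem hg)
  else Classical.choose (existsImplementer_schrodingerSB_rankOne ψ μ hd.cont hd.selfDual g)

/-- `r(g)` implements `g` (condition (A)). [cite: MoeglinVignerasWaldspurger1987, Chap. 2 II.1 (A)] -/
theorem localSectionFun_implements (g : Sp₁) :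
    Implements (rhoPsi hd.cont) (ofSymplectic _ g) (localSectionFun μ hd g) := by
  classical
  unfold localSectionFun
  split_ifs with hg
  · exact (Classical.choose_spec
      (exists_implementer_fixing_unramifiedVector ψ μ hd.cont hd.cond hd.selfDual hd.two_mem hg)).1
  · exact Classical.choose_spec (existsImplementer_schrodingerSB_rankOne ψ μ hd.cont hd.selfDual g)

/-- **`r(k)` fixes the unramified vector** for `k ∈ K = SL₂(𝒪)`. [cite: MoeglinVignerasWaldspurger1987, Chap. 2 II.10] -/
theorem localSectionFun_unramifiedVector {g : Sp₁} (hg : g ∈ integralSp₁ F) :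
    localSectionFun μ hd g (unramifiedVector F) = unramifiedVector F := by
  classical
  unfold localSectionFun
  rw [dif_pos hg]
  exact (Classical.choose_spec
    (exists_implementer_fixing_unramifiedVector ψ μ hd.cont hd.cond hd.selfDual hd.two_mem hg)).2

/-- **uniqueness of the normalised implementer**: an implementer of `g ∈ K` fixing `1_𝒪` is `r(g)`.
[cite: MoeglinVignerasWaldspurger1987, Chap. 2 II.10] -/
theorem eq_localSectionFun {g : Sp₁} (hg : g ∈ integralSp₁ F) {M : SchwartzBruhat F ≃ₗ[ℂ] SchwartzBruhat F}
    (hM : Implements (rhoPsi hd.cont) (ofSymplectic _ g) M) (hfix : M (unramifiedVector F) = unramifiedVector F) :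
    M = localSectionFun μ hd g := by
  refine implementer_eq_of_apply_eq _ hd.unique (localSectionFun_implements μ hd g) hM (f₀ := unramifiedVector F) ?_ ?_
  · rw [localSectionFun_unramifiedVector μ hd hg]; exact unramifiedVector_ne_zero
  · rw [hfix, localSectionFun_unramifiedVector μ hd hg]

/-- **`r(1) = 1`**. [cite: MoeglinVignerasWaldspurger1987, Chap. 2 II.10] -/
theorem localSectionFun_one : localSectionFun μ hd 1 = 1 := by
  refine (eq_localSectionFun μ hd (integralSp₁ F).one_mem ?_ rfl).symm
  rw [map_one]
  exact Implements.one _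

/-- **`r` is multiplicative on `K`**: `r(kk') = r(k) r(k')`. [cite: MoeglinVignerasWaldspurger1987, Chap. 2 II.10] -/
theorem localSectionFun_mul_of_mem {g g' : Sp₁} (hg : g ∈ integralSp₁ F) (hg' : g' ∈ integralSp₁ F) :
    localSectionFun μ hd (g * g') = localSectionFun μ hd g * localSectionFun μ hd g' := by
  refine (eq_localSectionFun μ hd ((integralSp₁ F).mul_mem hg hg') ?_ ?_).symm
  · rw [map_mul]
    exact Implements.mul _ (localSectionFun_implements μ hd g) (localSectionFun_implements μ hd g')
  · rw [LinearEquiv.mul_apply, localSectionFun_unramifiedVector μ hd hg', localSectionFun_unramifiedVector μ hd hg]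

/-- **the normalised local section as an `ImplementerSection` of `ρ_ψ`** (`r(g)` implements `g`, `r(1) = 1`).
[cite: MoeglinVignerasWaldspurger1987, Chap. 2 II.10] -/
def localSection : ImplementerSection (rhoPsi hd.cont) where
  toFun := localSectionFun μ hd
  implements' := localSectionFun_implements μ hd
  map_one' := localSectionFun_one μ hd

/-- unfolding. [folklore] -/
@[simp] theorem localSection_apply (g : Sp₁) : localSection μ hd g = localSectionFun μ hd g := rfl

/-- `r(g)` implements `g`. [cite: MoeglinVignerasWaldspurger1987, Chap. 2 II.1 (A)] -/
theorem localSection_implements (g : Sp₁) :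
    Implements (rhoPsi hd.cont) (ofSymplectic _ g) (localSection μ hd g) :=
  localSectionFun_implements μ hd g

/-- `(g, r(g)) ∈ S̃p_ψ`. [cite: MoeglinVignerasWaldspurger1987, Chap. 2 II.1 (A)] -/
theorem localSection_mem_MpPsi (g : Sp₁) : (g, localSection μ hd g) ∈ MpPsi (rhoPsi hd.cont) :=
  localSectionFun_implements μ hd g

/-- `r(k) 1_𝒪 = 1_𝒪` for `k ∈ K` (the `hK` input of a restricted tensor product). [cite: MoeglinVignerasWaldspurger1987, Chap. 2 II.10] -/
theorem localSection_unramifiedVector {g : Sp₁} (hg : g ∈ integralSp₁ F) :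
    localSection μ hd g (unramifiedVector F) = unramifiedVector F :=
  localSectionFun_unramifiedVector μ hd hg

/-- `r(1) = 1` (the `h1` input). [cite: MoeglinVignerasWaldspurger1987, Chap. 2 II.10] -/
theorem localSection_one : localSection μ hd 1 = 1 := localSectionFun_one μ hd

/-- `r(kk') = r(k) r(k')` on `K`. [cite: MoeglinVignerasWaldspurger1987, Chap. 2 II.10] -/
theorem localSection_mul_of_mem {g g' : Sp₁} (hg : g ∈ integralSp₁ F) (hg' : g' ∈ integralSp₁ F) :
    localSection μ hd (g * g') = localSection μ hd g * localSection μ hd g' :=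
  localSectionFun_mul_of_mem μ hd hg hg'

/-- **the compact open splitting `K = SL₂(𝒪) →* GL(𝒮(F))`, `k ↦ r(k)`** (MVW Chap. 2 II.10: over the stabiliser
of a self-dual lattice the metaplectic extension splits, residual characteristic `≠ 2`, `ψ` of conductor `𝒪`),
KERNEL in rank one. [cite: MoeglinVignerasWaldspurger1987, Chap. 2 II.10] -/
def localSectionK : integralSp₁ F →* (SchwartzBruhat F ≃ₗ[ℂ] SchwartzBruhat F) where
  toFun k := localSection μ hd k
  map_one' := localSection_one μ hd
  map_mul' k k' := localSection_mul_of_mem μ hd k.2 k'.2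

/-- formula for the splitting. [cite: MoeglinVignerasWaldspurger1987, Chap. 2 II.10] -/
@[simp] theorem localSectionK_apply (k : integralSp₁ F) : localSectionK μ hd k = localSection μ hd k := rfl

/-- the splitting lands in `S̃p_ψ` over `K`: `k ↦ (k, r(k))` is a homomorphism `K →* S̃p_ψ` lifting the inclusion.
[cite: MoeglinVignerasWaldspurger1987, Chap. 2 II.10] -/
def liftK : integralSp₁ F →* MpPsi (rhoPsi hd.cont) where
  toFun k := ⟨(k, localSection μ hd k), localSection_mem_MpPsi μ hd k⟩
  map_one' := Subtype.ext (Prod.ext rfl (localSection_one μ hd))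
  map_mul' k k' := Subtype.ext (Prod.ext rfl (localSection_mul_of_mem μ hd k.2 k'.2))

/-- `p ∘ liftK` is the inclusion `K ≤ SL₂(F)`. [cite: MoeglinVignerasWaldspurger1987, Chap. 2 II.10] -/
theorem proj_liftK (k : integralSp₁ F) : MpPsi.proj (rhoPsi hd.cont) (liftK μ hd k) = k := rfl

end Section

/-! ## §2 The cocycle of the normalised section, the local Weil representation, the splitting of `K` -/

section Cocycle

/-- **the local metaplectic cocycle** `c_ψ : SL₂(F) × SL₂(F) → ℂˣ` of the normalised section (a normalised central
2-cocycle, tree `CentralCocycle`). [cite: MoeglinVignerasWaldspurger1987, Chap. 2 II.1] -/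
def localCocycle : CentralCocycle Sp₁ ℂˣ :=
  (localSection μ hd).cocycle hd.unique

/-- **`r(g) (r(g') f) = c(g,g') • r(gg') f`**. [cite: MoeglinVignerasWaldspurger1987, Chap. 2 II.1] -/
theorem localSection_mul_apply (g g' : Sp₁) (f : SchwartzBruhat F) :
    localSection μ hd g (localSection μ hd g' f) = (localCocycle μ hd g g' : ℂ) • localSection μ hd (g * g') f :=
  (localSection μ hd).mul_apply hd.unique g g' f

/-- the scalar in `r(g) r(g') = c · r(gg')` is unique. [folklore] -/
theorem localCocycle_unique {g g' : Sp₁} {c : ℂˣ}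
    (hc : ∀ f, localSection μ hd g (localSection μ hd g' f) = (c : ℂ) • localSection μ hd (g * g') f) :
    c = localCocycle μ hd g g' :=
  (localSection μ hd).cocycleFun_unique hd.unique hc

/-- **multiplier relation in the tree's shape** (`hr`): `HasMultiplier c (unitScalar ℂ 𝒮(F)) r` in `End(𝒮(F))`.
[cite: MoeglinVignerasWaldspurger1987, Chap. 2 II.1] -/
theorem hasMultiplier_localSection :
    TwistedProduct.HasMultiplier (localCocycle μ hd) (unitScalar ℂ (SchwartzBruhat F))
      fun g => (localSection μ hd g : Module.End ℂ (SchwartzBruhat F)) :=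
  (localSection μ hd).hasMultiplier hd.unique

/-- `r(1) = 1` in `End(𝒮(F))` (`h1`). [folklore] -/
theorem localSection_one_end : ((localSection μ hd 1 : SchwartzBruhat F ≃ₗ[ℂ] SchwartzBruhat F) :
    Module.End ℂ (SchwartzBruhat F)) = 1 :=
  (localSection μ hd).coe_map_one

/-- scalars commute with the section (`hz`). [folklore] -/
theorem commute_unitScalar_localSection (a : ℂˣ) (g : Sp₁) :
    Commute (unitScalar ℂ (SchwartzBruhat F) a) (localSection μ hd g : Module.End ℂ (SchwartzBruhat F)) :=
  (localSection μ hd).commute_unitScalar a g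

/-- **the cocycle is trivial on `K × K`** (`r` is multiplicative there). [cite: MoeglinVignerasWaldspurger1987, Chap. 2 II.10] -/
theorem localCocycle_eq_one_of_mem {g g' : Sp₁} (hg : g ∈ integralSp₁ F) (hg' : g' ∈ integralSp₁ F) :
    localCocycle μ hd g g' = 1 :=
  ((localSection μ hd).cocycle_eq_one_iff hd.unique g g').2 (localSection_mul_of_mem μ hd hg hg')

/-- normalisation `c(1,g) = 1`. [folklore] -/
theorem localCocycle_one_left (g : Sp₁) : localCocycle μ hd 1 g = 1 :=
  (localSection μ hd).cocycle_one_left hd.unique g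

/-- normalisation `c(g,1) = 1`. [folklore] -/
theorem localCocycle_one_right (g : Sp₁) : localCocycle μ hd g 1 = 1 :=
  (localSection μ hd).cocycle_one_right hd.unique g

/-- **the local Weil representation of the twisted product `SL₂(F) ×_c ℂˣ` on `𝒮(F)`**: `(g, a) ↦ a · r(g)`, a genuine
homomorphism. [cite: MoeglinVignerasWaldspurger1987, Chap. 2 II.1] -/
def localWeilOp : TwistedProduct (localCocycle μ hd) →* Module.End ℂ (SchwartzBruhat F) :=
  (localSection μ hd).weilOp hd.unique

/-- formula `localWeilOp (g, a) f = a • r(g) f`. [cite: MoeglinVignerasWaldspurger1987, Chap. 2 II.1] -/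
theorem localWeilOp_apply (x : TwistedProduct (localCocycle μ hd)) (f : SchwartzBruhat F) :
    localWeilOp μ hd x f = (x.a : ℂ) • localSection μ hd x.g f := rfl

/-- **`K` splits into the local metaplectic twisted product** with `β = 1` (`TwistedProduct.IsSplitting`).
[cite: MoeglinVignerasWaldspurger1987, Chap. 2 II.10] -/
theorem isSplitting_integralSp₁ :
    TwistedProduct.IsSplitting (localCocycle μ hd) (integralSp₁ F).subtype fun _ => 1 :=
  (localSection μ hd).isSplitting_of_mul hd.unique _ fun _ hg _ hg' => localSection_mul_of_mem μ hd hg hg'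

end Cocycle

/-! ## §3 The group shape: `G = S̃p_ψ`, `Kc =` the lifted `SL₂(𝒪)`, the fixed unramified vector -/

section GroupShape

/-- **the unramified compact subgroup of `S̃p_ψ`**: the image of the splitting `liftK : SL₂(𝒪) →* S̃p_ψ`.
[cite: MoeglinVignerasWaldspurger1987, Chap. 2 II.10] -/
def unramifiedStabilizer : Subgroup (MpPsi (rhoPsi hd.cont)) :=
  (liftK μ hd).range

/-- elements of the unramified compact subgroup are the `(k, r(k))`, `k ∈ SL₂(𝒪)`. [folklore] -/
theorem mem_unramifiedStabilizer_iff (p : MpPsi (rhoPsi hd.cont)) :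
    p ∈ unramifiedStabilizer μ hd ↔ ∃ k : integralSp₁ F, liftK μ hd k = p :=
  MonoidHom.mem_range

/-- `proj` maps the unramified compact subgroup onto `SL₂(𝒪)`. [folklore] -/
theorem proj_mem_integralSp₁ {p : MpPsi (rhoPsi hd.cont)} (hp : p ∈ unramifiedStabilizer μ hd) :
    MpPsi.proj (rhoPsi hd.cont) p ∈ integralSp₁ F := by
  obtain ⟨k, rfl⟩ := (mem_unramifiedStabilizer_iff μ hd p).1 hp
  rw [proj_liftK]
  exact k.2

/-- **the unramified vector is fixed by the unramified compact subgroup** under the tautological representation of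
`S̃p_ψ` — the `hK` input of `⊗'_v` in the shape `x₀ ∈ (r v).fixedPoints (Kc v)`.
[cite: MoeglinVignerasWaldspurger1987, Chap. 2 II.10] -/
theorem unramifiedVector_mem_fixedPoints :
    (unramifiedVector F : SchwartzBruhat F) ∈ (MpPsi.toRep (rhoPsi hd.cont)).fixedPoints (unramifiedStabilizer μ hd) := by
  rw [Representation.mem_fixedPoints]
  intro p hp
  obtain ⟨k, rfl⟩ := (mem_unramifiedStabilizer_iff μ hd p).1 hp
  exact localSection_unramifiedVector μ hd k.2

/-- the tautological representation on the lifted `SL₂(𝒪)` is the splitting: `toRep (liftK k) = r(k)`. [folklore] -/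
theorem toRep_liftK (k : integralSp₁ F) :
    MpPsi.toRep (rhoPsi hd.cont) (liftK μ hd k) = (localSection μ hd k : Module.End ℂ (SchwartzBruhat F)) := rfl

end GroupShape

/-! ## §4 Any conductor: a normalised section and its cocycle at every finite place -/

section AnyConductor

omit hd
variable (hψ : ψ.IsContinuousNontrivial) (hμ : IsSelfDualMeasure ψ μ)
include hψ hμ

/-- **a normalised section of implementers for ANY continuous non-trivial `ψ`** (any conductor; `μ` self-dual):
`r(1) = 1`, `r(g)` some implementer (rank-one existence THEOREM). [cite: MoeglinVignerasWaldspurger1987, Chap. 2 II.1 (A)] -/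
def rankOneSection : ImplementerSection (rhoPsi hψ) :=
  ImplementerSection.ofExists _ (existsImplementer_schrodingerSB_rankOne ψ μ hψ hμ)

/-- its cocycle `SL₂(F) × SL₂(F) → ℂˣ` (normalised central 2-cocycle). [cite: MoeglinVignerasWaldspurger1987, Chap. 2 II.1] -/
def rankOneCocycle : CentralCocycle Sp₁ ℂˣ :=
  (rankOneSection μ hψ hμ).cocycle (implementerUniqueUpToScalar_schrodingerSB_rankOne _ _ hψ)

/-- `r(g) (r(g') f) = c(g,g') • r(gg') f`. [cite: MoeglinVignerasWaldspurger1987, Chap. 2 II.1] -/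
theorem rankOneSection_mul_apply (g g' : Sp₁) (f : SchwartzBruhat F) :
    rankOneSection μ hψ hμ g (rankOneSection μ hψ hμ g' f)
      = (rankOneCocycle μ hψ hμ g g' : ℂ) • rankOneSection μ hψ hμ (g * g') f :=
  (rankOneSection μ hψ hμ).mul_apply (implementerUniqueUpToScalar_schrodingerSB_rankOne _ _ hψ) g g' f

/-- multiplier relation (`hr`) for the any-conductor section. [cite: MoeglinVignerasWaldspurger1987, Chap. 2 II.1] -/
theorem hasMultiplier_rankOneSection :
    TwistedProduct.HasMultiplier (rankOneCocycle μ hψ hμ) (unitScalar ℂ (SchwartzBruhat F))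
      fun g => (rankOneSection μ hψ hμ g : Module.End ℂ (SchwartzBruhat F)) :=
  (rankOneSection μ hψ hμ).hasMultiplier (implementerUniqueUpToScalar_schrodingerSB_rankOne _ _ hψ)

/-- `r(1) = 1` (`h1`). [folklore] -/
theorem rankOneSection_one : rankOneSection μ hψ hμ 1 = 1 := (rankOneSection μ hψ hμ).map_one

/-- the Weil representation of `SL₂(F) ×_c ℂˣ` for the any-conductor section. [cite: MoeglinVignerasWaldspurger1987, Chap. 2 II.1] -/
def rankOneWeilOp : TwistedProduct (rankOneCocycle μ hψ hμ) →* Module.End ℂ (SchwartzBruhat F) :=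
  (rankOneSection μ hψ hμ).weilOp (implementerUniqueUpToScalar_schrodingerSB_rankOne _ _ hψ)

end AnyConductor

end Literature.RepresentationTheory.HeisenbergGroup
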